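import Mathlib
import Summits.ValiantsHypothesis.ValiantsHypothesis.Theorems.BarrierLeverPartitionMinorsHitByVPHiddenStatesSecondShellEqualYCross

/-!
# Route BarrierLever — item `PartitionMinorsHitByVP` (stmt-ValiantsHypothesis-19717), line `hidden-states`:
# ★★ SECOND-SHELL «EQUAL-Y» CLASSES — the third CANCELLATION cell (swapped bottoms, cyclic digraph)

Helper file (`--supports stmt-ValiantsHypothesis-19717`; cell valiant-natproofs, 𝒟-side door (c), registered line
`Cruxes/PartitionMinorsHitByVP/Lines/hidden_states.lean` v8; prover seat val-np-p6 gen 17).  Closes NO item; definition-free.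

EQUAL-Y (memo §4 «three movers», toolkit `…SecondShellEqualYRows`, vanishing `…SecondShellEqualYCross`): `C₁∖A₁ = C₂∖A₂ = {y_b,y_p,y_q}`, `A₁∖C₁ = {x₁,x₂}`,
`A₂∖C₂ = {q₁,q₂}`, `x₁ ∈ C₂` (an inert token of the start row), `x₂ ∉ C₂`, `x₂ ∉ {q₁,q₂}`.  Orientation with SWAPPED
BOTTOMS: path 1 = (y_b < y_p < y_q) with `x₁,x₂` attached at `y_b`, path 2 = (y_p < y_b < y_q) with `q₁,q₂` attached at
`y_p`.  With `Z = A₂ ∩ C₂`, for every parameter `(ε₀ε₁ − 1)·row(C₂) = Σ_T μ_T row(Z ∪ T)` over twenty rows none of which is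
`A₁` (the only pure-attachment pair is `Z ∪ {q₁,q₂} = A₂ ≠ A₁`), so `(ε₀ε₁−1)·D_{B−A₁+C₂} ≡ 0`, hence `D_{B−A₁+C₂} ≡ 0`
(`det_tab2_eq_zero_of_mul`) and `…SecondShellExchange` composes: ★★ `exists_table_secondShell_equalY` — discharges the LAST
open t = 3 class {012,013;0456,1456} (y_b,y_p,y_q = 4,5,6; x₁,x₂ = 1,2; q₁,q₂ = 0,3), completing the second shell of B₃(7).

HONEST LABEL: conjecture-column cells (second shell, every `t, h`); 19717 stays OPEN; nothing on crux 14610 or VP ≠ VNP.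
-/

set_option linter.dupNamespace false

namespace Summit.ValiantsHypothesis.ValiantsHypothesis.Theorems.BarrierLever.HiddenStates

open Finset

noncomputable section

namespace SecondShell

open PathTable

/-! ## ★★ The equal-Y cell -/

/-- ★★ **SECOND SHELL, EQUAL-Y CLASSES, EVERY `t, h`.**  `C₁∖A₁ = C₂∖A₂ = {y_b,y_p,y_q}`, `A₁∖C₁ = {x₁,x₂}`,
`A₂∖C₂ = {q₁,q₂}`, `x₁ ∈ C₂`, `x₂ ∉ C₂ ∪ {q₁,q₂}`: the class is served. -/
theorem exists_table_secondShell_equalY (h t : ℕ) (A₁ A₂ C₁ C₂ : Finset (Fin h))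
    (hA₁ : A₁.card = t) (hA₂ : A₂.card = t) (hC₁ : C₁.card = t + 1) (hC₂ : C₂.card = t + 1)
    (h₁ : ¬ A₁ ⊆ C₁) (h₂ : ¬ A₂ ⊆ C₂) (hA : A₁ ≠ A₂) (hC : C₁ ≠ C₂)
    {yb yp yq x₁ x₂ q₁ q₂ : Fin h}
    (hY₁ : C₁ \ A₁ = {yb, yp, yq}) (hY₂ : C₂ \ A₂ = {yb, yp, yq}) (hbp : yb ≠ yp) (hbq : yb ≠ yq) (hpq : yp ≠ yq)
    (hX₁ : A₁ \ C₁ = {x₁, x₂}) (hx : x₁ ≠ x₂) (hX₂ : A₂ \ C₂ = {q₁, q₂}) (hq : q₁ ≠ q₂)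
    (hx₁C : x₁ ∈ C₂) (hx₂C : x₂ ∉ C₂) (nxq₁ : x₂ ≠ q₁) (nxq₂ : x₂ ≠ q₂)
    {r : ℕ} (u cols : Fin r → Finset (Fin h)) (hu : Function.Injective u)
    (hU : ∀ i, ((u i).card ≤ t ∧ u i ≠ A₁ ∧ u i ≠ A₂) ∨ u i = C₁ ∨ u i = C₂)
    (hcols : ∀ J : Finset (Fin h), J.card ≤ t → ∃ kk, cols kk = J) :
    ∃ tx : Option (Fin h) → Fin h → ℂ,
      (Matrix.of fun i kk : Fin r => ∏ a ∈ u i, (tx none a + ∑ q ∈ cols kk, tx (some q) a)).det ≠ 0 := by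
  classical
  obtain ⟨k₁, j₁, j₁', hk₁, hkj₁, a1, a2, a3, a4⟩ := swap_sizes A₁ C₁ hA₁ hC₁ h₁
  obtain ⟨k₂, j₂, j₂', hk₂, hkj₂, b1, b2, b3, b4⟩ := swap_sizes A₂ C₂ hA₂ hC₂ h₂
  -- sizes: `k₁ = k₂ = 2`
  have h3 : ({yb, yp, yq} : Finset (Fin h)).card = 3 := by
    rw [Finset.card_insert_of_notMem (by simp [hbp, hbq]), Finset.card_pair hpq]
  have hY₁c : (C₁ \ A₁).card = 3 := by rw [hY₁, h3]
  have hY₂c : (C₂ \ A₂).card = 3 := by rw [hY₂, h3]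
  obtain rfl : k₁ = 2 := by omega
  obtain rfl : k₂ = 2 := by omega
  -- membership facts
  have hyb₁ : yb ∈ C₁ \ A₁ := by rw [hY₁]; simp
  have hyq₁ : yq ∈ C₁ \ A₁ := by rw [hY₁]; simp
  have hx₁ : x₁ ∈ A₁ \ C₁ := by rw [hX₁]; simp
  have hx₂ : x₂ ∈ A₁ \ C₁ := by rw [hX₁]; simp
  have hyp₂ : yp ∈ C₂ \ A₂ := by rw [hY₂]; simp
  have hyq₂ : yq ∈ C₂ \ A₂ := by rw [hY₂]; simp
  have hq₁ : q₁ ∈ A₂ \ C₂ := by rw [hX₂]; simp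
  have hq₂ : q₂ ∈ A₂ \ C₂ := by rw [hX₂]; simp
  -- transports: path 1 = (yb < yp < yq) with x₁, x₂ at yb; path 2 = (yp < yb < yq) with q₁, q₂ at yp
  obtain ⟨e₁, m1, m2, m3, m4, htop₁, hbot₁, hatt₁, hatt₁'⟩ := exists_equiv_four_oriented A₁ C₁ hk₁ a1 a2 a3 a4
    hyq₁ hyb₁ hbq.symm hx₁ hx₂ (fun _ => hx)
  obtain ⟨e₂, n1, n2, n3, n4, htop₂, hbot₂, hatt₂, hatt₂'⟩ := exists_equiv_four_oriented A₂ C₂ hk₂ b1 b2 b3 b4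
    hyq₂ hyp₂ hpq.symm hq₁ hq₂ (fun _ => hq)
  have hatt₁1 : e₁ (Sum.inl (Sum.inr ⟨1, by omega⟩)) = x₂ := hatt₁' (le_refl 2)
  have hatt₂1 : e₂ (Sum.inl (Sum.inr ⟨1, by omega⟩)) = q₂ := hatt₂' (le_refl 2)
  -- the middles
  have hmid₁ : e₁ (Sum.inl (Sum.inl 1)) = yp := by
    have hmem := m1 1
    rw [hY₁] at hmem
    simp only [Finset.mem_insert, Finset.mem_singleton] at hmem
    rcases hmem with h' | h' | h'
    · exfalso
      have := e₁.injective (h'.trans hbot₁.symm)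
      simp at this
    · exact h'
    · exfalso
      have := e₁.injective (h'.trans htop₁.symm)
      simp [Fin.ext_iff] at this
  have hmid₂ : e₂ (Sum.inl (Sum.inl 1)) = yb := by
    have hmem := n1 1
    rw [hY₂] at hmem
    simp only [Finset.mem_insert, Finset.mem_singleton] at hmem
    rcases hmem with h' | h' | h'
    · exact h'
    · exfalso
      have := e₂.injective (h'.trans hbot₂.symm)
      simp at this
    · exfalso
      have := e₂.injective (h'.trans htop₂.symm)
      simp [Fin.ext_iff] at this
  let N₁ : Fin h → Fin h → ℂ := fun a q => swapTable' e₁ a q - if q = a then 1 else 0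
  let N₂ : Fin h → Fin h → ℂ := fun a q => swapTable' e₂ a q - if q = a then 1 else 0
  have hT10 : tab2 N₁ N₂ ![1, 0] = swapTable' e₁ := by funext a q; simp [tab2, N₁]
  have hT01 : tab2 N₁ N₂ ![0, 1] = swapTable' e₂ := by funext a q; simp [tab2, N₂]
  -- bookkeeping (verbatim from the immobile-token cell)
  set Ball := Finset.univ.filter fun S : Finset (Fin h) => S.card ≤ t with hBall
  set 𝒰 := insert C₁ (insert C₂ ((Ball.erase A₁).erase A₂)) with h𝒰
  have hBA₁ : A₁ ∈ Ball := Finset.mem_filter.2 ⟨Finset.mem_univ _, by omega⟩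
  have hBA₂ : A₂ ∈ Ball := Finset.mem_filter.2 ⟨Finset.mem_univ _, by omega⟩
  have hBC₁ : C₁ ∉ Ball := fun h' => by have := (Finset.mem_filter.1 h').2; omega
  have hBC₂ : C₂ ∉ Ball := fun h' => by have := (Finset.mem_filter.1 h').2; omega
  have h𝒰card : 𝒰.card = Ball.card := card_secondShell_rows Ball hBA₁ hBA₂ hBC₁ hBC₂ hA hC
  have hUmem : ∀ i, u i ∈ 𝒰 := by
    intro i
    rcases hU i with ⟨hc, hne₁, hne₂⟩ | h' | h'
    · refine Finset.mem_insert_of_mem (Finset.mem_insert_of_mem ?_)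
      exact Finset.mem_erase.2 ⟨hne₂, Finset.mem_erase.2 ⟨hne₁, Finset.mem_filter.2 ⟨Finset.mem_univ _, hc⟩⟩⟩
    · rw [h']; exact Finset.mem_insert_self _ _
    · rw [h']; exact Finset.mem_insert_of_mem (Finset.mem_insert_self _ _)
  obtain ⟨hhit, hcolcard⟩ := rows_cover t 𝒰 h𝒰card u cols hu hUmem hcols
  obtain ⟨i₁, hi₁⟩ := hhit C₁ (Finset.mem_insert_self _ _)
  obtain ⟨i₂, hi₂⟩ := hhit C₂ (Finset.mem_insert_of_mem (Finset.mem_insert_self _ _))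
  have hne : i₁ ≠ i₂ := fun h' => hC (by rw [← hi₁, ← hi₂, h'])
  have hball : ∀ R : Finset (Fin h), R.card ≤ t → R ≠ A₁ → R ≠ A₂ → ∃ i, i ≠ i₁ ∧ i ≠ i₂ ∧ u i = R := by
    intro R hR hR₁ hR₂
    obtain ⟨i, hi⟩ := hhit R (Finset.mem_insert_of_mem (Finset.mem_insert_of_mem
      (Finset.mem_erase.2 ⟨hR₂, Finset.mem_erase.2 ⟨hR₁, Finset.mem_filter.2 ⟨Finset.mem_univ _, hR⟩⟩⟩)))
    refine ⟨i, ?_, ?_, hi⟩ <;> (rintro rfl; first | (rw [hi₁] at hi) | (rw [hi₂] at hi)) <;> (rw [← hi] at hR; omega)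
  let b : Fin r → Finset (Fin h) := Function.update (Function.update u i₁ A₁) i₂ A₂
  have hb₁ : b i₁ = A₁ := by simp only [b, Function.update_of_ne hne, Function.update_self]
  have hb₂ : b i₂ = A₂ := by simp only [b, Function.update_self]
  have hb : ∀ i, i ≠ i₁ → i ≠ i₂ → b i = u i := fun i h1 h2 => by simp only [b, Function.update_of_ne h2, Function.update_of_ne h1]
  have hub : Function.update (Function.update b i₁ C₁) i₂ C₂ = u := by
    funext i
    by_cases h2 : i = i₂
    · subst h2; rw [Function.update_self, hi₂]
    · rw [Function.update_of_ne h2]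
      by_cases h1 : i = i₁
      · subst h1; rw [Function.update_self, hi₁]
      · rw [Function.update_of_ne h1, hb i h1 h2]
  have hbval : ∀ i, i ≠ i₁ → i ≠ i₂ → (b i).card ≤ t ∧ b i ≠ A₁ ∧ b i ≠ A₂ := by
    intro i h1 h2
    rw [hb i h1 h2]
    rcases hU i with h' | h' | h'
    · exact h'
    · exact absurd (hi₁ ▸ h') (fun hh => h1 (hu hh))
    · exact absurd (hi₂ ▸ h') (fun hh => h2 (hu hh))
  have hAu : ∀ i, u i ≠ A₁ ∧ u i ≠ A₂ := by
    intro i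
    rcases hU i with ⟨-, hne₁, hne₂⟩ | h' | h'
    · exact ⟨hne₁, hne₂⟩
    · rw [h']; constructor <;> (intro h''; rw [h''] at hC₁; omega)
    · rw [h']; constructor <;> (intro h''; rw [h''] at hC₂; omega)
  have hbinj : Function.Injective b := by
    refine update_injective _ (update_injective u hu i₁ A₁ fun i => (hAu i).1) i₂ A₂ fun i' => ?_
    by_cases h' : i' = i₁
    · rw [h', Function.update_self]; exact hA
    · rw [Function.update_of_ne h']; exact (hAu i').2
  have hC₁b : ∀ i, b i ≠ C₁ := by
    intro i h'
    by_cases h1 : i = i₁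
    · rw [h1, hb₁] at h'; rw [h'] at hA₁; omega
    by_cases h2 : i = i₂
    · rw [h2, hb₂] at h'; rw [h'] at hA₂; omega
    · rw [hb i h1 h2, ← hi₁] at h'; exact h1 (hu h')
  have hC₂b : ∀ i, b i ≠ C₂ := by
    intro i h'
    by_cases h1 : i = i₁
    · rw [h1, hb₁] at h'; rw [h'] at hA₁; omega
    by_cases h2 : i = i₂
    · rw [h2, hb₂] at h'; rw [h'] at hA₂; omega
    · rw [hb i h1 h2, ← hi₂] at h'; exact h2 (hu h')
  have hF1 : (mat (tab2 N₁ N₂ ![1, 0]) (Function.update b i₁ C₁) cols).det ≠ 0 := by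
    rw [hT10]
    refine swapTable'_det_ne_zero hk₁ A₁ C₁ e₁ m1 m2 m3 m4 _ cols (update_injective b hbinj i₁ C₁ hC₁b) ?_
      (by rw [hkj₁]; exact hcols)
    intro i
    by_cases hi : i = i₁
    · right; rw [hi, Function.update_self]
    · left
      rw [Function.update_of_ne hi]
      by_cases h2 : i = i₂
      · rw [h2, hb₂]; exact ⟨by omega, Ne.symm hA⟩
      · have := hbval i hi h2; exact ⟨by rw [hkj₁]; exact this.1, this.2.1⟩
  have hF2 : (mat (tab2 N₁ N₂ ![0, 1]) (Function.update b i₂ C₂) cols).det ≠ 0 := by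
    rw [hT01]
    refine swapTable'_det_ne_zero hk₂ A₂ C₂ e₂ n1 n2 n3 n4 _ cols (update_injective b hbinj i₂ C₂ hC₂b) ?_
      (by rw [hkj₂]; exact hcols)
    intro i
    by_cases hi : i = i₂
    · right; rw [hi, Function.update_self]
    · left
      rw [Function.update_of_ne hi]
      by_cases h1 : i = i₁
      · rw [h1, hb₁]; exact ⟨by omega, hA⟩
      · have := hbval i h1 hi; exact ⟨by rw [hkj₂]; exact this.1, this.2.2⟩
  -- rows of the cross minor `D_{B − A₁ + C₂}` other than `i₁`
  have key : ∀ S : Finset (Fin h), S.card ≤ t → S ≠ A₁ → ∃ i, i ≠ i₁ ∧ Function.update b i₁ C₂ i = S := by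
    intro S hS hS₁
    by_cases hS₂ : S = A₂
    · exact ⟨i₂, hne.symm, by rw [Function.update_of_ne hne.symm, hb₂, hS₂]⟩
    · obtain ⟨i, hi1, hi2, hi⟩ := hball S hS hS₁ hS₂
      exact ⟨i, hi1, by rw [Function.update_of_ne hi1, hb i hi1 hi2, hi]⟩
  -- ★ the cancellation (`…SecondShellEqualYCross`)
  have hZ : ∀ ε, (mat (tab2 N₁ N₂ ε) (Function.update b i₁ C₂) cols).det = 0 :=
    equalY_cross_det_eq_zero t A₁ A₂ C₁ C₂ hA₁ hC₂ hA hY₁ hY₂ hbp hbq hpq hx₁ hx₂ hX₂ hq hx₁C hx₂C nxq₁ nxq₂ e₁ e₂ m1 n1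
      hbot₁ hmid₁ htop₁ (show (⟨0, hk₁⟩ : Fin 2) ≠ ⟨1, by omega⟩ by simp) hatt₁ hatt₁1 hbot₂ hmid₂ htop₂
      (show (⟨0, hk₂⟩ : Fin 2) ≠ ⟨1, by omega⟩ by simp) hatt₂ hatt₂1 (Function.update b i₁ C₂) cols i₁
      (Function.update_self _ _ _) key hcolcard
  obtain ⟨tx, htx⟩ := exists_table_of_cross_zero N₁ N₂ b cols hne C₁ C₂ hF1 hF2 (Or.inl hZ)
  exact ⟨tx, by rw [hub] at htx; exact htx⟩

end SecondShell

end

end Summit.ValiantsHypothesis.ValiantsHypothesis.Theorems.BarrierLever.HiddenStates
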